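import Summits.QuantumFields.YangMills.Theorems.FlatTubeReductionBOAssemblyRatePot
import Summits.QuantumFields.YangMills.Theorems.FlatTubeReductionRecordRateBricks
import Summits.QuantumFields.YangMills.Theorems.FlatTubeReductionDressedNearTopTwoSided
import Summits.QuantumFields.YangMills.Theorems.FlatTubeReductionOuterCoercive
import HarnessLib

/-!
# THE HAND-OFF OBJECT OF «ratepack-v3 / frozen fibres»: `RecordBORatePotInput L s K M` — the analytic bricks at rate grade for the record weight with a FROZEN-admissible
# profile; ALL structural fields of `BORateBricksPot` and `hTop` discharged; K1 from one such input per `L ≥ 2`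
# (route `FlatTubeReduction`, crux K1 `NearFlatRatioLaw` stmt-QuantumFields-24720; seat `ym-line-ftr-p1` g12; R2b1 RECORD rung — no summit statement is proved here)

`RecordBORatePotInput L s K M` = what the pooled rate-twin seat must SUPPLY for the record weight `χ = recordChi L s K M` (lane A): a colour-equivariant fibre profile family
`Ω β u v` (FROZEN allowed: independent of `u`), `|Ω| ≤ 1`, supported in `{‖v‖ ≤ r β}`; the DRESSED one-site weight `W β` (PHYSICAL: gauge AND twist invariant, `0 ≤ W ≤ C_W`,
two-sided `|W² − 1| ≤ κ_W·orbitDist²` on `{orbitDist < δ₁}` — the exact diagonal ratio of the fibre-sandwiched kernel); a slow radius `δ₁` with lane A's SHADOW (S1),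
`√λ_b(L³β) ≤ δ₁` and the CORE condition `κ_Wδ₁², (4κ_b/θ₀)δ₁² ≤ Aλ_b(L³β)` (all true for `δ₁ = D_L·β^{-1/6}`, `K > 3L³D_L`); rates `κ, b² = O(λ_b²)`; and the four ANALYTIC bricks:
(B-N) fibre mass (exact for a frozen profile after normalisation), (B-T)-RATE against the dressed one-site form, (B-ST) stiff domination, (B-OD) IN POTENTIAL FORM
(`√(b²‖·‖² + κ_bγ∫_{orbitDist<δ₁} orbitDist²φ²)`, colour-invariant `φ`).
* ★★★ `boRateBricksPot_record : RecordBORatePotInput L s K M → BORateBricksPot L (recordChi L s K M) β^{-s}` — every structural field + `hTop` (`hTop_of_twoSided`, p670140) discharged;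
* ★★★★ `nearFlatRatioLaw_of_recordRatePotInput` — K1 `NearFlatRatioLaw` ⟸ (∀ L ≥ 2, `RecordBORatePotInput L (1/6) (K L) (M L)`, `K ≥ 1`, `M ≥ 2`, BOTH MAY DEPEND ON `L`) + lane A's
  SHELL; (EM) is the tree theorem `RateTube.oneSiteEigenMoments`.
HONEST FRAMING: the input is OPEN fixed-lattice semiclassics (second-order two-slice Laplace asymptotics of the frozen-fibre BO kernel, no log losses at `s = 1/6`; pooled with
RED lane A's (B-T) pen); femto rung R2b1 (RECORD label); not infinite volume, not a gap, not Clay.  One `structure`, one instance `def`, no named facts, no `sorry`.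
-/

set_option autoImplicit false

noncomputable section

open MeasureTheory Filter Topology Real
open scoped BigOperators
open Literature.MathematicalPhysics.QuantumFieldTheory
open Literature.MathematicalPhysics.QuantumLattice

namespace Summit.QuantumFields.YangMills.Theorems.FemtoTransferGap.RateTube

open Summit.QuantumFields.YangMills.Theorems.FemtoTransferGap
open Summit.QuantumFields.YangMills.Theorems.FemtoTransferGap.TwoLattice.Avg
open Summit.QuantumFields.YangMills.Theorems.FemtoTransferGap.TwoLattice.ConstTube
open Summit.QuantumFields.YangMills.Theorems.FemtoTransferGap.TwoLattice.Stiff (LinkSpace)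
open Summit.QuantumFields.YangMills.Theorems.FemtoCutoffLadder

variable {L : ℕ} [NeZero L]

/-! ## §1 The input a successor must supply (rate grade, frozen fibres admissible) -/

variable (L) in
/-- **THE RATE-GRADE INPUT WITH POTENTIAL FOR THE RECORD WEIGHT** (see the module docstring). [cite: Luscher1983, §3] [cite: SjostrandZworski2007, §2] -/
structure RecordBORatePotInput (s K M : ℝ) where
  /-- fibre profile (frozen allowed), dressed weight, radii, rates and constants -/
  Ω : ℝ → GaugeConfig 3 1 SU2 → LinkSpace L → ℝ
  W : ℝ → GaugeConfig 3 1 SU2 → ℝ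
  r : ℝ → ℝ
  δ₁ : ℝ → ℝ
  σ : ℝ → ℝ
  γ : ℝ → ℝ
  κ : ℝ → ℝ
  b : ℝ → ℝ
  θ₀ : ℝ
  κW : ℝ
  κb : ℝ
  A : ℝ
  CW : ℝ
  hΩm : ∀ β, Measurable (Function.uncurry (Ω β))
  hΩ1 : ∀ β u x, |Ω β u x| ≤ 1
  hΩinv : ∀ β (g : SU2) (u : GaugeConfig 3 1 SU2) (v : LinkSpace L), Ω β (gaugeTransform (fun _ : Site 3 1 => g) u) (adL L g v) = Ω β u v
  hΩr : ∀ β u x, Ω β u x ≠ 0 → ‖x‖ ≤ r β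
  /-- the dressed weight is PHYSICAL (gauge AND twist invariant), `0 ≤ W ≤ C_W`, two-sided near the vacuum -/
  hWphys : ∀ β, IsPhys (W β)
  hW0 : ∀ β u, 0 ≤ W β u
  hWbU : ∀ β u, |W β u| ≤ CW
  hκW : 0 ≤ κW
  hκb : 0 ≤ κb
  hA : 0 ≤ A
  hWsq : ∀ β u, orbitDist u < δ₁ β → |W β u ^ 2 - 1| ≤ κW * orbitDist u ^ 2
  /-- the slow window `{orbitDist < δ₁}` is a rate CORE for the dressing AND the potential -/
  hδ₁win : ∃ β1 : ℝ, ∀ β : ℝ, β1 ≤ β → 0 < δ₁ β ∧ δ₁ β ≤ 1 / 2 ∧ κW * δ₁ β ^ 2 ≤ A * bareLambda ((L : ℝ) ^ 3 * β) ∧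
    4 * κb / θ₀ * δ₁ β ^ 2 ≤ A * bareLambda ((L : ℝ) ^ 3 * β)
  hr : ∀ β, 0 ≤ r β ∧ r β ≤ 1 / 2
  hγ : ∀ β, 0 < γ β
  /-- the window contains the one-site near-top quasimode (`√λ_b(L³β) ≤ δ₁`) and the BO support sits inside the weight's support -/
  hcoreR : ∀ᶠ β in atTop, Real.sqrt (bareLambda ((L : ℝ) ^ 3 * β)) ≤ δ₁ β
  hradii : ∀ᶠ β in atTop, (Fintype.card (Edge 3 L) : ℝ) * (4 * r β + δ₁ β) < K * powScale s β
  /-- (S1) the slow shadow of the test support (lane A's `recordChi_shadow` at `δ₁ ≥ 14β^{-s}/|Site|`) -/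
  hshadow : ∀ᶠ β in atTop, ∀ U : GaugeConfig 3 L SU2, recordChi L s K M β U ≠ 0 → orbitDist U < powScale s β → orbitDist (slowMean L U) < δ₁ β
  hσ : ∀ β, 0 < σ β
  hκ0 : ∀ β, 0 ≤ κ β
  hκ_small : ∃ a : ℝ, ∀ᶠ β in atTop, κ β ≤ a * bareLambda ((L : ℝ) ^ 3 * β) ^ 2
  hb : ∀ β, 0 ≤ b β
  hb_small : ∃ a : ℝ, ∀ᶠ β in atTop, b β ^ 2 ≤ a * bareLambda ((L : ℝ) ^ 3 * β) ^ 2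
  hθ₀ : 0 < θ₀ ∧ θ₀ ≤ 1
  /-- (B-N) the fibre mass on the window -/
  hN : ∀ᶠ β in atTop, ∀ u : GaugeConfig 3 1 SU2, orbitDist u < δ₁ β → |fibreMassAd L (softWeight (recordChi L s K M β)) (Ω β) u - γ β| ≤ κ β * γ β
  /-- (B-T)-RATE the kernel on BO functions against the DRESSED one-site form -/
  hT : ∀ᶠ β in atTop, ∀ φ : GaugeConfig 3 1 SU2 → ℝ, Measurable φ → (∃ C : ℝ, ∀ u, |φ u| ≤ C) →
    (∀ (g : Site 3 1 → SU2) (u : GaugeConfig 3 1 SU2), φ (gaugeTransform g u) = φ u) → (∀ u, φ u ≠ 0 → orbitDist u < δ₁ β) →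
    |tubeForm β (boFunAd L φ (Ω β)) - σ β * γ β * qform su2Rep ((L : ℝ) ^ 3 * β) (fun u => φ u * W β u) (fun u => φ u * W β u)| ≤
      κ β * (σ β * γ β) * (qform su2Rep ((L : ℝ) ^ 3 * β) (fun u => φ u * W β u) (fun u => φ u * W β u) + levelValue su2Rep 1 ((L : ℝ) ^ 3 * β) 0 * l2 φ φ)
  /-- (B-ST) stiff domination -/
  hST : ∀ᶠ β in atTop, ∀ v : GaugeConfig 3 L SU2 → ℝ, Measurable v → (∃ C : ℝ, ∀ U, |v U| ≤ C) → (∀ U, v U ≠ 0 → recordChi L s K M β U ≠ 0) →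
    (∀ u, fibreInnerAd L (softWeight (recordChi L s K M β)) (Ω β) v u = 0) →
    tubeForm β v ≤ (1 - θ₀) * (σ β * levelValue su2Rep 1 ((L : ℝ) ^ 3 * β) 0) * tubeNormSq (softWeight (recordChi L s K M β)) v
  /-- (B-OD) IN POTENTIAL FORM, for colour-invariant slow amplitudes -/
  hODpot : ∀ᶠ β in atTop, ∀ (φ : GaugeConfig 3 1 SU2 → ℝ) (v : GaugeConfig 3 L SU2 → ℝ), Measurable φ → (∃ C : ℝ, ∀ u, |φ u| ≤ C) →
    (∀ (g : Site 3 1 → SU2) (u : GaugeConfig 3 1 SU2), φ (gaugeTransform g u) = φ u) → (∀ u, φ u ≠ 0 → orbitDist u < δ₁ β) →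
    Measurable v → (∃ C : ℝ, ∀ U, |v U| ≤ C) → (∀ U, v U ≠ 0 → recordChi L s K M β U ≠ 0) →
    (∀ u, fibreInnerAd L (softWeight (recordChi L s K M β)) (Ω β) v u = 0) →
    |tubeCross β (boFunAd L φ (Ω β)) v| ≤ (σ β * levelValue su2Rep 1 ((L : ℝ) ^ 3 * β) 0) *
        Real.sqrt (b β ^ 2 * tubeNormSq (softWeight (recordChi L s K M β)) (boFunAd L φ (Ω β)) +
          κb * γ β * ∫ u, (if orbitDist u < δ₁ β then orbitDist u ^ 2 else 0) * φ u ^ 2 ∂configMeasure SU2 1) *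
        Real.sqrt (tubeNormSq (softWeight (recordChi L s K M β)) v) ∧
    |tubeCross β v (boFunAd L φ (Ω β))| ≤ (σ β * levelValue su2Rep 1 ((L : ℝ) ^ 3 * β) 0) *
        Real.sqrt (b β ^ 2 * tubeNormSq (softWeight (recordChi L s K M β)) (boFunAd L φ (Ω β)) +
          κb * γ β * ∫ u, (if orbitDist u < δ₁ β then orbitDist u ^ 2 else 0) * φ u ^ 2 ∂configMeasure SU2 1) *
        Real.sqrt (tubeNormSq (softWeight (recordChi L s K M β)) v)

/-! ## §2 ★★★ The v3 brick list for the record weight -/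

/-- `κ_W·λ_b(L³β) ≤ 1/2` eventually. [folklore] -/
theorem kW_bareLambda_eventually_le {κW : ℝ} (hκW : 0 ≤ κW) : ∀ᶠ β : ℝ in atTop, κW * bareLambda ((L : ℝ) ^ 3 * β) ≤ 1 / 2 := by
  set τ : ℝ := 1 / (2 * κW + 1) with hτ
  have hτ0 : 0 < τ := by rw [hτ]; positivity
  filter_upwards [Filter.eventually_ge_atTop (2 / τ ^ 3)] with β hβ
  have h := bareLambda_cube_le (L := L) hτ0 hβ
  have h1 : κW * bareLambda ((L : ℝ) ^ 3 * β) ≤ κW * τ := mul_le_mul_of_nonneg_left h hκW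
  have h2 : κW * τ ≤ 1 / 2 := by
    rw [hτ, mul_one_div, div_le_iff₀ (by positivity)]; linarith
  exact h1.trans h2

set_option maxHeartbeats 400000 in
/-- ★★★ **`BORateBricksPot` FOR THE RECORD WEIGHT from the rate input with potential**: all structural fields and `hTop` discharged (g9's `boRateBricks_record` for the structure;
`hTop_of_twoSided` for `hTop`, using `hcoreR` and `κ_Wλ_b ≤ 1/2` eventually). [cite: Luscher1983, §3] -/
def boRateBricksPot_record {s K M : ℝ} (hs : 0 < s) (hM : 1 ≤ M) (I : RecordBORatePotInput L s K M) :
    BORateBricksPot L (recordChi L s K M) (powScale s) where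
  Ω := I.Ω
  W := I.W
  𝒰 := fun β => {u | orbitDist u < I.δ₁ β}
  σ := I.σ
  γ := I.γ
  κ := I.κ
  b := I.b
  c := fun β => Real.exp (-((Fintype.card (Edge 3 L) : ℝ) / powScale 1 β ^ 2))
  θ₀ := I.θ₀
  δ₁ := I.δ₁
  δ₂ := fun β => (Fintype.card (Edge 3 L) : ℝ) * (4 * I.r β + I.δ₁ β)
  m := 1 / (2 * L)
  hχm := fun β => (recordChi_props s K M β).1
  hχ1 := fun β => (recordChi_props s K M β).2.1
  hχ0 := fun β => (recordChi_props s K M β).2.2.1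
  hc := fun β => ⟨Real.exp_pos _, fun U hU => ((recordChi_props s K M β).2.2.2 U hU).1⟩
  hwm := fun β => (softWeight_recordChi_props s K M β).1
  hwb := fun β => ⟨_, (softWeight_recordChi_props s K M β).2.1⟩
  hw0 := fun β => (softWeight_recordChi_props s K M β).2.2.1
  hwinv := fun β => (softWeight_recordChi_props s K M β).2.2.2
  hΩm := I.hΩm
  hΩ1 := I.hΩ1
  hΩinv := I.hΩinv
  hWphys := I.hWphys
  hW0 := I.hW0
  CW := I.CW
  hWbU := I.hWbU
  κW := I.κW
  κb := I.κb
  A := I.A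
  hκW := I.hκW
  hκb := I.hκb
  hA := I.hA
  hWsq := I.hWsq
  hδ₁win := I.hδ₁win
  h𝒰m := fun β => measurableSet_lt measurable_orbitDist measurable_const
  h𝒰inv := fun β g u => by simp only [Set.mem_setOf_eq, orbitDist_gaugeTransform]
  h𝒰δ₁ := fun β u hu => hu
  hδ₁ := by
    obtain ⟨β1, h⟩ := I.hδ₁win
    filter_upwards [Filter.eventually_ge_atTop β1] with β hβ
    exact (h β hβ).2.1
  htube := by
    have hρ0 : Tendsto (fun β => M * (K * powScale s β)) atTop (𝓝 0) := by
      have := (tendsto_powScale hs).const_mul K |>.const_mul M; simpa using this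
    filter_upwards [hρ0.eventually (gt_mem_nhds (show (0 : ℝ) < 1 / 5 by norm_num))] with β hρ U hU
    obtain ⟨-, hmem⟩ := (recordChi_props s K M β).2.2.2 U hU
    have hlink : ∀ e : Edge 3 L, 1 - 1 / 50 ≤ scalarPart (U e) := fun e => by
      have h1 := hmem.1 e
      have h2 := frobNorm_sub_one_sq_eq_scalarPart (U e)
      have h3 : frobNorm (((U e : SU2) : Matrix (Fin 2) (Fin 2) ℂ) - 1) ^ 2 ≤ (1 / 5) ^ 2 :=
        pow_le_pow_left₀ (frobNorm_nonneg _) (h1.le.trans hρ.le) 2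
      nlinarith [frobNorm_nonneg (((U e : SU2) : Matrix (Fin 2) (Fin 2) ℂ) - 1)]
    exact (mem_orthoTubeSet_of_near_one L (by norm_num) le_rfl hlink).2.1
  hshadow := by filter_upwards [I.hshadow] with β hβ U hU hd; exact hβ U hU hd
  hbo := by
    filter_upwards [I.hradii] with β hrad φ U hφ hU
    have hr := I.hr β
    have hcard1 : (1 : ℝ) ≤ Fintype.card (Edge 3 L) := by
      have : 0 < Fintype.card (Edge 3 L) := Fintype.card_pos_iff.mpr ⟨((fun _ => 0), 0)⟩
      exact_mod_cast this
    have hpos : 0 ≤ 4 * I.r β + I.δ₁ β := by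
      by_contra h; push Not at h
      obtain ⟨-, hφU, -⟩ := boFunAd_ne_zero L hU
      have h1 := hφ _ hφU; have h2 := orbitDist_nonneg (slowMean L U)
      have h3 : orbitDist (slowMean L U) < I.δ₁ β := h1
      linarith [hr.1]
    have hρ : 4 * I.r β + I.δ₁ β < M * (K * powScale s β) := by
      have h1 : 4 * I.r β + I.δ₁ β ≤ (Fintype.card (Edge 3 L) : ℝ) * (4 * I.r β + I.δ₁ β) := by nlinarith
      have h2 : K * powScale s β ≤ M * (K * powScale s β) := by
        have : 0 ≤ K * powScale s β := le_of_lt (lt_of_le_of_lt (by positivity) (h1.trans_lt hrad))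
        nlinarith
      linarith
    exact boFunAd_support_record (δ' := fun β => K * powScale s β) (ρ := fun b => M * (K * powScale s b)) (δg := powScale 1) hφ hr.2 (I.hΩr β) hρ hrad hU
  hm := by positivity
  hm0 := by
    have hL0 : (0 : ℝ) < L := by exact_mod_cast Nat.pos_of_ne_zero (NeZero.ne L)
    exact div_pos one_pos (by linarith)
  hδ₂ := by
    have hL0 : (0 : ℝ) < L := by exact_mod_cast Nat.pos_of_ne_zero (NeZero.ne L)
    have hρ0 : Tendsto (fun β => K * powScale s β) atTop (𝓝 0) := by
      have := (tendsto_powScale hs).const_mul K; simpa using this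
    filter_upwards [I.hradii, hρ0.eventually (gt_mem_nhds (show (0 : ℝ) < 1 / L by positivity))] with β hrad hsmall
    have h1 : (L : ℝ) * ((Fintype.card (Edge 3 L) : ℝ) * (4 * I.r β + I.δ₁ β)) < L * (1 / L) := mul_lt_mul_of_pos_left (hrad.trans hsmall) hL0
    rw [mul_one_div_cancel hL0.ne'] at h1
    have h2 : (L : ℝ) * (1 / (2 * L)) = 1 / 2 := by field_simp
    calc (L : ℝ) * ((Fintype.card (Edge 3 L) : ℝ) * (4 * I.r β + I.δ₁ β) + 1 / (2 * L))
        = (L : ℝ) * ((Fintype.card (Edge 3 L) : ℝ) * (4 * I.r β + I.δ₁ β)) + L * (1 / (2 * L)) := by ring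
      _ < 1 + 1 / 2 := by rw [h2]; linarith
      _ < 2 := by norm_num
  hσ := I.hσ
  hγ := I.hγ
  hκ := I.hκ0
  hb := I.hb
  hθ₀ := I.hθ₀
  hκ_small := I.hκ_small
  hb_small := I.hb_small
  hTop := by
    obtain ⟨C'', B₀, -, hD⟩ := hTop_of_twoSided (κW := I.κW) (CW := I.CW) I.hκW
    have hL1 : (1 : ℝ) ≤ (L : ℝ) ^ 3 := one_le_pow₀ (by exact_mod_cast NeZero.one_le)
    refine ⟨C'', ?_⟩
    filter_upwards [I.hcoreR, kW_bareLambda_eventually_le (L := L) I.hκW, Filter.eventually_ge_atTop (max B₀ 0)] with β hcore hkl hβ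
    have hβ0 : 0 ≤ β := (le_max_right _ _).trans hβ
    have hB : B₀ ≤ (L : ℝ) ^ 3 * β := ((le_max_left _ _).trans hβ).trans (by nlinarith)
    exact hD ((L : ℝ) ^ 3 * β) hB hkl (I.W β) (I.δ₁ β) (I.hWphys β).measurable (I.hWphys β).gaugeInv (I.hW0 β) (fun u => (abs_le.mp (I.hWbU β u)).2)
      (I.hWsq β) hcore {u | orbitDist u < I.δ₁ β} fun u _ hu => lt_of_lt_of_le hu hcore
  hN := by filter_upwards [I.hN] with β hβ u hu; exact hβ u hu
  hT := by filter_upwards [I.hT] with β hβ φ h1 h2 h3 h4; exact hβ φ h1 h2 h3 h4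
  hST := I.hST
  hODpot := by filter_upwards [I.hODpot] with β hβ φ v h1 h2 h3 h4 h5 h6 h7 h8; exact hβ φ v h1 h2 h3 h4 h5 h6 h7 h8

/-! ## §3 ★★★★ K1 from the rate input with potential -/

/-- ★★★★ **K1 `NearFlatRatioLaw` ⇐ the rate input with potential for the record weight** on every `L ≥ 2` (`s = 1/6`, fat factors `K L ≥ 1`, `M L ≥ 2` may depend on `L`)
**+ lane A's SHELL**: `boRateBricksPot_record`, the assembly `softTubeBORatePackagePotOn_of_bricksPot` with (EM) = the tree theorem `RateTube.oneSiteEigenMoments`,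
`innerRateAt_of_ratePackagePot` at `k = 1`, and the rate two-zone glue `nearFlatRatioLaw_of_coreRate_shell_pow`. [cite: Luscher1983, §3] -/
theorem nearFlatRatioLaw_of_recordRatePotInput (K M : ℕ → ℝ) (hK : ∀ L, 1 ≤ K L) (hM : ∀ L, 2 ≤ M L)
    (I : ∀ (L : ℕ) [NeZero L], 2 ≤ L → RecordBORatePotInput L (1 / 6) (K L) (M L))
    (hshell : ∀ (L : ℕ) [NeZero L], 2 ≤ L → InnerShellGainAt L (powScale (1 / 6)) (powScale (1 / 40))) :
    Summit.QuantumFields.YangMills.Theses.FlatTubeReduction.NearFlatRatioLaw :=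
  nearFlatRatioLaw_of_coreRate_shell_pow
    (fun L _ hL => innerRateAt_of_ratePackagePot (L := L) 1 (fun β => powScale_pos (1 / 6) β) powScale_sixth_eventually_le
      (softTubeAdmissible_recordChi' (1 / 6) (K L) (M L) (hK L) (hM L))
      (softTubeBORatePackagePotOn_of_bricksPot oneSiteEigenMoments (boRateBricksPot_record (by norm_num) (by linarith [hM L]) (I L hL))))
    hshell

end Summit.QuantumFields.YangMills.Theorems.FemtoTransferGap.RateTube

end
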